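import Literature.AlgebraicGeometry.Frobenioids.Thm36SubModelProofs
import Literature.AlgebraicGeometry.Frobenioids.Thm36SubProofs2
import Literature.AlgebraicGeometry.Frobenioids.PerfectionCoAngular
import Literature.AlgebraicGeometry.Frobenioids.PerfectionProofs
import HarnessLib

/-!
# Frobenioids II, Thm. 3.6 (i) for `C^ℚ := C^pf`: "there is a natural equivalence of categories
# `(C^Λ)^un-tr ⥲ C^ℝ`, compatible with the Frobenioid structures" — PROVED at `Λ = ℚ`

Mochizuki, *The geometry of Frobenioids II: poly-Frobenioids*, Kyushu J. Math. **62** (2008) 401–460, §3,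
Thm. 3.6 (i), kurims text p. 36 (journal p. 431): "For arbitrary `Λ`, there is a natural equivalence of categories
`(C^Λ)^un-tr ⥲ C^ℝ`, compatible with the Frobenioid structures" [cite: MochizukiFrdII2008, Thm 3.6 (i) p.36]; proof
p. 38: "The existence of a natural equivalence of categories `(C^Λ)^un-tr ⥲ C^ℝ`, compatible with the Frobenioid
structures, follows immediately from the construction of `C^Λ`."  Here `Λ = ℚ`: `C^ℚ := C^pf` is THE perfection of
the archimedean Frobenioid `C → F_Φ` of Ex. 3.3 (ii) ([FrdI] Def. 3.1 (iii), abc-iut-L1-d9's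
`PreFrobenioid.Perfection hF`; sub-DAG vocabulary `Thm36Sub.pfCat/pfStr` of abc-iut-w4-d074) and `C^ℝ := C^rlf` THE
realification ([FrdI] Prop. 5.3).

PROOF-ONLY file (abc-iut cell, layer L1, row «M13-c5»; seat abc-iut-w5-d237, gen 4).  The statement is the
`Λ = ℚ` twin of abc-iut-w4-d074's slots `Thm36Sub.untrEquiv_Z` / `untrEquiv_R` (`Thm36SubModel.lean`, proved in
`Thm36SubModelProofs.lean`), in the typed form of abc-iut-L1-t9's generic predicate `Thm36i_untrEquiv FU FR`
(`ArchimedeanBasicProperties.lean`): `(C^ℚ)^un-tr` in its MODEL DESCRIPTION — the model Frobenioid ([FrdI] Thm. 5.2) of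
the data `(Φ^pf, (Φ^pf)^birat)`, i.e. the divisor monoid `(Perfection.ops hF).monFunctor` (= `Φ^pf`, d9's
`PerfectionOps.lean`) and abc-iut-L1-t5's concrete `biratSubfunctor (pfStr π hF)` ([FrdI] Prop. 4.4 (iii)) with its
inclusion — read in `F_{Φ^rlf}` along the natural homomorphism `Φ^pf → Φ^rlf` of divisor monoids ([FrdI] Prop. 5.3,
bottom row, `RealificationData.pfToRlfNatTrans`), is equivalent over `F_{Φ^rlf}` to `C^rlf` with its structure functor
`rlfStr`.  No new definition: the statement is spelled with the existing vocabulary only (a slot name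
`Thm36Sub.untrEquiv_Q` may be attached by the slot-table holder).  Contents, everything PROVED:
* **`biratSubfunctor_pfStr_carrier_eq_top`**: `(Φ^pf)^birat = (Φ^pf)^gp` for `C^pf` — at the object `(Y, 1)` over
  `X ∈ Ob(D)` (`Y` the isotropic unit object of `C` over `X`, `unitObjOver`), the identity (co-angular: every arrow out
  of an isotropic object of `C` is co-angular, `C.isCoAngular_of_isIsotropic`, transported by d9's
  `preservesMor_isCoAngular`) and the image under `C → C^pf` of the radial endomorphism with divisor `t`
  (`exists_radialEndC_div_eq`, a pre-step by `preservesMor_isPreStep`) form a base-equivalent pre-step pair with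
  birational germ `[t]⁻¹ ∈ (Φ^pf)^gp(X)` (`div_toPf`, `baseMap_toPf`); since `Φ(X) = ℝ_{≥0}` is perfect
  (`isPerfect_multiplicative_nnreal`), the `[t]` exhaust `Φ^pf(X)`, so the germs generate everything;
* `bijective_pfToRlfNatTrans_app`: `Φ^pf(X) → Φ^rlf(X)` is bijective (injective: Def. 2.4 (i)(c),
  `IsPerfFactorial.Rlf.toRealification_injective`; onto: w4-d074's `toRlf_surjective`);
* `monGp_map_pfToRlfNatTrans_pullGp`: naturality of `(Φ^pf → Φ^rlf)^gp` in pull-backs;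
* **`untrEquiv_Q_holds`**: the morphism of model data `(Φ^pf, (Φ^pf)^birat, incl) → (Φ^rlf, ℝ · Φ^birat, incl)` over
  `𝟭_D` with `η = (Φ^pf → Φ^rlf)`, `β = η^gp` has bijective components (`ℝ · Φ^birat = (Φ^rlf)^gp`,
  `realSpan_carrier_eq_top`), hence (abc-iut-w5-d137's `ModelFrobenioid.DataHomOver.functor_isEquivalence`, [FrdI]
  Cor. 5.4) induces an equivalence `(C^ℚ)^un-tr ⥲ C^ℝ`, compatible on the nose with the structure functors to
  `F_{Φ^rlf}` — w4-d074's `untrEquiv_Z_holds` with `Φ ↦ Φ^pf`, `ι ↦ ι^{pf→rlf}`.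
No definitions; no statement of the paper is strengthened or re-typed; nothing here bears on [IUTchIII] Cor. 3.12
(classical, refereed [FrdI]/[FrdII]); typed ≠ proved except where a `theorem` says so.
-/

noncomputable section

namespace Literature.AlgebraicGeometry.Frobenioids

open CategoryTheory Opposite Function Literature.AnabelianGeometry.EtaleTheta
open scoped NNReal

universe v u

namespace ArchFrd

namespace Thm36Sub

variable {D : Type u} [Category.{v} D] (π : D ⥤ D0)

open PreFrobenioid PreFrobenioid.Perfection

/-! ### `(Φ^pf)^birat = (Φ^pf)^gp` for THE perfection of the archimedean Frobenioid -/

/-- **`(Φ^pf)^birat(X) = (Φ^pf)^gp(X)`** for `C^pf` ([FrdI] Prop. 4.4 (iii), abc-iut-L1-t5's concrete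
`biratSubfunctor` of the structure `pfStr`): at the object `(Y, 1)` of `C^pf` over `X` (`Y` the isotropic unit
object of `C` over `X`) the identity — a co-angular pre-step — and the image under `C → C^pf` of the radial
endomorphism of `Y` with divisor `t` are base-equivalent pre-steps with birational germ `[t]⁻¹`; since
`Φ(X) = ℝ_{≥0}` is perfect the `[t]`, `t ∈ Φ(X)`, exhaust `Φ^pf(X)`, so the germs generate `(Φ^pf)^gp(X)`.
[cite: MochizukiFrdI2008, Prop. 4.4 (iii) p.83] -/
theorem biratSubfunctor_pfStr_carrier_eq_top (hF : PreFrobenioid.IsFrobenioid (C.toElem π)) (X : D) :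
    (PreFrobenioid.biratSubfunctor (pfStr π hF)).carrier X = ⊤ := by
  -- the unit object `Y` of `C` over `X` and its image `(Y, 1)` in `C^pf`
  have hof : ∀ t : (Φ π).obj (op X),
      Algebra.GrothendieckGroup.of (Frobenioids.Perfection.of _ t) ∈
        (PreFrobenioid.biratSubfunctor (pfStr π hF)).carrier X := by
    intro t
    obtain ⟨r, hr, ht⟩ := exists_radialEndC_div_eq π (unitObjOver π X) t
    have h₁ : PreFrobenioid.IsCoAngularPreStep (pfStr π hF) (𝟙 ((toPf hF).obj (unitObjOver π X))) := by
      refine ⟨?_, PreFrobenioid.isPreStep_id' (pfStr π hF) _⟩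
      have h := preservesMor_isCoAngular hF (𝟙 (unitObjOver π X))
        ((PreFrobenioidData.ofFunctor_isCoAngular (C.toElem π) _).mpr
          (C.isCoAngular_of_isIsotropic π (𝟙 _) (isIsotropic_unitObjOver π X)))
      rw [CategoryTheory.Functor.map_id] at h
      exact (PreFrobenioidData.ofFunctor_isCoAngular (pfStr π hF) _).mp h
    have h₂ : PreFrobenioid.IsPreStep (pfStr π hF) ((toPf hF).map (radialEndC π (unitObjOver π X) r hr)) :=
      preservesMor_isPreStep hF (radialEndC π (unitObjOver π X) r hr)
        ((PreFrobenioidData.ofFunctor_isPreStep (C.toElem π) _).mpr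
          ⟨rfl, by change IsIso (𝟙 X); infer_instance⟩)
    have hb : PreFrobenioid.BaseEquivalent (pfStr π hF) (𝟙 ((toPf hF).obj (unitObjOver π X)))
        ((toPf hF).map (radialEndC π (unitObjOver π X) r hr)) := by
      unfold PreFrobenioid.BaseEquivalent
      rw [PreFrobenioid.base_id]
      change 𝟙 _ = Hom.baseMap ((toPf hF).map (radialEndC π (unitObjOver π X) r hr))
      rw [baseMap_toPf]
      rfl
    have hmem := PreFrobenioid.div_invDiv_mem_biratSubfunctor (F := pfStr π hF) _ _ h₁ h₂ hb
    have e₁ : PreFrobenioid.invDiv (pfStr π hF) (𝟙 ((toPf hF).obj (unitObjOver π X))) h₁.2.2 = 1 := by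
      unfold PreFrobenioid.invDiv
      rw [PreFrobenioid.div_id, map_one]
    have e₂ : PreFrobenioid.invDiv (pfStr π hF) ((toPf hF).map (radialEndC π (unitObjOver π X) r hr)) h₂.2 =
        Frobenioids.Perfection.of _ t := by
      haveI : IsIso (PreFrobenioid.Base (pfStr π hF) ((toPf hF).map (radialEndC π (unitObjOver π X) r hr))) :=
        h₂.2
      have hbase : PreFrobenioid.Base (pfStr π hF) ((toPf hF).map (radialEndC π (unitObjOver π X) r hr)) =
          𝟙 X := by
        change Hom.baseMap ((toPf hF).map (radialEndC π (unitObjOver π X) r hr)) = 𝟙 X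
        rw [baseMap_toPf]
        rfl
      have hinv : inv (PreFrobenioid.Base (pfStr π hF)
          ((toPf hF).map (radialEndC π (unitObjOver π X) r hr))) = 𝟙 X :=
        IsIso.inv_eq_of_hom_inv_id (by rw [hbase]; exact Category.comp_id _)
      unfold PreFrobenioid.invDiv
      rw [hinv]
      erw [pull_id]
      change Hom.div ((toPf hF).map (radialEndC π (unitObjOver π X) r hr)) = _
      rw [div_toPf, ht]
      rfl
    rw [e₁, e₂, map_one, one_div] at hmem
    exact (Subgroup.inv_mem_iff _).mp hmem
  refine eq_top_iff.mpr fun γ _ => ?_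
  obtain ⟨a, b, hab⟩ := grothendieckGroup_exists_mul_of_eq_of γ
  rw [eq_div_of_mul_eq' hab]
  obtain ⟨ta, rfl⟩ := (isPerfect_iff_bijective_of.mp isPerfect_multiplicative_nnreal).2 a
  obtain ⟨tb, rfl⟩ := (isPerfect_iff_bijective_of.mp isPerfect_multiplicative_nnreal).2 b
  exact div_mem (hof ta) (hof tb)

/-! ### `Φ^pf → Φ^rlf` is bijective for the archimedean Frobenioid -/

/-- For the archimedean Frobenioid, `Φ^pf(X) → Φ^rlf(X)` (the factorization homomorphism of [FrdI] Def. 2.4 (i)(c))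
is BIJECTIVE: injective in general (`IsPerfFactorial.Rlf.toRealification_injective`), onto because already
`Φ(X) → Φ^pf(X) → Φ^rlf(X)` is onto (`Φ = ℝ_{≥0}` is `ℝ`-monoprime; w4-d074's `toRlf_surjective`).
[cite: MochizukiFrdI2008, Prop. 5.3 p.103] -/
theorem bijective_pfToRlfNatTrans_app (X : Dᵒᵖ) :
    Bijective ((RealificationData.pfToRlfNatTrans (Φ π)
      (PreFrobenioid.IsPerfFactorialOn.op (isPerfFactorialOn_Φ π))).app X).hom := by
  refine ⟨IsPerfFactorial.Rlf.toRealification_injective _, fun b => ?_⟩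
  obtain ⟨m, hm⟩ := toRlf_surjective π X b
  exact ⟨Frobenioids.Perfection.of _ m, hm⟩

/-- Naturality of `(Φ^pf → Φ^rlf)^gp` with respect to pull-backs (the groupification of the naturality of
`Φ^pf ⟶ Φ^rlf`), for the divisor monoid `Φ^pf` of THE perfection. [cite: MochizukiFrdI2008, Prop. 5.3 p.103] -/
theorem monGp_map_pfToRlfNatTrans_pullGp (hF : PreFrobenioid.IsFrobenioid (C.toElem π)) {X Y : D} (f : X ⟶ Y)
    (c : Algebra.GrothendieckGroup ((PreFrobenioid.Perfection.ops hF).monFunctor.obj (op Y))) :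
    MonGp.map ((RealificationData.pfToRlfNatTrans (Φ π)
        (PreFrobenioid.IsPerfFactorialOn.op (isPerfFactorialOn_Φ π))).app (op X)).hom
      (pullGp (PreFrobenioid.Perfection.ops hF).monFunctor f c) =
    pullGp (rlfFunctor (Φ π) (PreFrobenioid.IsPerfFactorialOn.op (isPerfFactorialOn_Φ π))) f
      (MonGp.map ((RealificationData.pfToRlfNatTrans (Φ π)
        (PreFrobenioid.IsPerfFactorialOn.op (isPerfFactorialOn_Φ π))).app (op Y)).hom c) := by
  let ι : (PreFrobenioid.Perfection.ops hF).monFunctor ⟶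
      rlfFunctor (Φ π) (PreFrobenioid.IsPerfFactorialOn.op (isPerfFactorialOn_Φ π)) :=
    RealificationData.pfToRlfNatTrans (Φ π) (PreFrobenioid.IsPerfFactorialOn.op (isPerfFactorialOn_Φ π))
  have key : (MonGp.map (ι.app (op X)).hom).comp (pullGp (PreFrobenioid.Perfection.ops hF).monFunctor f) =
      (pullGp (rlfFunctor (Φ π) (PreFrobenioid.IsPerfFactorialOn.op (isPerfFactorialOn_Φ π))) f).comp
        (MonGp.map (ι.app (op Y)).hom) := by
    apply MonGp.hom_ext
    intro a
    have h := congrArg (fun g => (CommMonCat.Hom.hom g) a) (ι.naturality f.op)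
    simp only [MonoidHom.comp_apply, pullGp, MonGp.map_of]
    exact congrArg Algebra.GrothendieckGroup.of h
  exact DFunLike.congr_fun key c

/-! ### Theorem 3.6 (i), "`(C^ℚ)^un-tr ⥲ C^ℝ`", for `C^ℚ := C^pf` -/

/-- **[FrdII] Thm. 3.6 (i) for `C^ℚ := C^pf`, "there is a natural equivalence of categories `(C^Λ)^un-tr ⥲ C^ℝ`,
compatible with the Frobenioid structures", `Λ = ℚ` — PROVED** over any base `π : D → D₀` (the `Λ = ℚ` twin of
abc-iut-w4-d074's `untrEquiv_Z_holds` / `untrEquiv_R_holds`): the unit-trivialisation `(C^pf)^un-tr` in its model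
description — the model Frobenioid of `(Φ^pf, (Φ^pf)^birat)` ([FrdI] Prop. 5.3), with its structure functor read in
`F_{Φ^rlf}` along `Φ^pf → Φ^rlf` — is equivalent over `F_{Φ^rlf}` to THE realification `C^ℝ = C^rlf`: the morphism
of model data `(Φ^pf, (Φ^pf)^birat, incl) → (Φ^rlf, ℝ · Φ^birat, incl)` over `𝟭_D` has bijective components
(`bijective_pfToRlfNatTrans_app`, `biratSubfunctor_pfStr_carrier_eq_top`, `realSpan_carrier_eq_top`), so it
induces an equivalence of model Frobenioids (abc-iut-w5-d137's `DataHomOver.functor_isEquivalence`, [FrdI] Cor. 5.4),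
compatible on the nose with the structure functors.  The binder `hF` ("`C` is a Frobenioid", Ex. 3.3 (ii)) is the
PARAMETER of the construction `C^pf`.  [cite: MochizukiFrdII2008, Thm 3.6 (i) p.36] -/
theorem untrEquiv_Q_holds (hF : PreFrobenioid.IsFrobenioid (C.toElem π)) :
    Literature.AlgebraicGeometry.Frobenioids.ArchFrd.Thm36i_untrEquiv
      (ModelFrobenioid.toElem (PreFrobenioid.Perfection.ops hF).monFunctor
          (PreFrobenioid.biratSubfunctor (pfStr π hF)).toMonoid
          (PreFrobenioid.biratSubfunctor (pfStr π hF)).incl ⋙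
        ElemFrobenioid.mapNatTrans
          (RealificationData.pfToRlfNatTrans (Φ π) (PreFrobenioid.IsPerfFactorialOn.op (isPerfFactorialOn_Φ π)) :
            (PreFrobenioid.Perfection.ops hF).monFunctor ⟶
              rlfFunctor (Φ π) (PreFrobenioid.IsPerfFactorialOn.op (isPerfFactorialOn_Φ π))))
      (rlfStr π) := by
  let R := RealificationData.canonical (Φ π) (PreFrobenioid.IsPerfFactorialOn.op (isPerfFactorialOn_Φ π))
  let Ψ := PreFrobenioid.biratSubfunctor (C.toElem π)
  let Ψq := PreFrobenioid.biratSubfunctor (pfStr π hF)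
  let ι : (PreFrobenioid.Perfection.ops hF).monFunctor ⟶ R.rlf :=
    RealificationData.pfToRlfNatTrans (Φ π) (PreFrobenioid.IsPerfFactorialOn.op (isPerfFactorialOn_Φ π))
  have hmem : ∀ (X : D) (c : Algebra.GrothendieckGroup (R.rlf.obj (op X))), c ∈ (R.realSpan Ψ).carrier X :=
    fun X c => by rw [realSpan_carrier_eq_top]; exact Subgroup.mem_top _
  have hmemq : ∀ (X : D) (c : Algebra.GrothendieckGroup ((PreFrobenioid.Perfection.ops hF).monFunctor.obj (op X))),
      c ∈ Ψq.carrier X :=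
    fun X c => by rw [biratSubfunctor_pfStr_carrier_eq_top]; exact Subgroup.mem_top _
  -- the morphism of model data `(Φ^pf, (Φ^pf)^birat, incl) → (Φ^rlf, ℝ·Φ^birat, incl)` over the identity of `D`
  let h : ModelFrobenioid.DataHomOver (𝟭 D) Ψq.incl (R.realSpan Ψ).incl :=
    { η := { app := fun X => ι.app X
             naturality := fun X Y f => ι.naturality f }
      β := { app := fun X => CommMonCat.ofHom
               (((MonGp.map (ι.app X).hom).comp (Ψq.carrier (unop X)).subtype).codRestrict
                 ((R.realSpan Ψ).carrier (unop X)) fun c => hmem (unop X) _)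
             naturality := fun X Y f => by
               apply CommMonCat.hom_ext
               apply MonoidHom.ext
               intro c
               apply Subtype.ext
               exact monGp_map_pfToRlfNatTrans_pullGp π hF f.unop c.1 }
      comm := fun A u => rfl }
  have hη : ∀ X : D, Bijective (h.η.app (op X)).hom := fun X => bijective_pfToRlfNatTrans_app π (op X)
  have hβ : ∀ X : D, Bijective (h.β.app (op X)).hom := fun X => by
    have hι := bijective_monGp_map _ (bijective_pfToRlfNatTrans_app π (op X))
    refine ⟨fun a b hab => Subtype.ext (hι.1 (congrArg Subtype.val hab)), fun y => ?_⟩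
    obtain ⟨x, hx⟩ := hι.2 y.1
    exact ⟨⟨x, hmemq X x⟩, Subtype.ext hx⟩
  haveI hequiv : h.functor.IsEquivalence := h.functor_isEquivalence hη hβ
  let compIso : h.functor ⋙ rlfStr π ≅
      ModelFrobenioid.toElem (PreFrobenioid.Perfection.ops hF).monFunctor Ψq.toMonoid Ψq.incl ⋙
        ElemFrobenioid.mapNatTrans ι :=
    NatIso.ofComponents (fun X => Iso.refl _) (fun {X Y} φ =>
      (Category.comp_id _).trans ((ElemFrobenioid.Hom.ext rfl rfl rfl).trans (Category.id_comp _).symm))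
  exact ⟨h.functor.asEquivalence, ⟨compIso⟩⟩

end Thm36Sub

end ArchFrd

end Literature.AlgebraicGeometry.Frobenioids

end
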